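import Summits.NavierStokesRegularity.NavierStokesRegularity.Theorems.LerayQuarterDissipationFiniteDissipationLiouvilleFinalDatumProfile
import Literature.Analysis.FluidPDE.NewtonPotentialHolder
import HarnessLib

/-!
# Crux `FiniteDissipationLiouville` (stmt-NavierStokesRegularity-22144): the FINITE-ENERGY
# REMAINDER — the singular part `W(t) − u₀` of a Type-I profile lies in `L²(ℝ³)` with energy
# `≤ M √(−t)`

Theorems file of route `LerayQuarterDissipation` (lead prover ns-lqd-lead g9; `--supports` the
crux, line `birth`; portrait facts for the registered stub `stub_envelopeCriticalLiouville`).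
Navier–Stokes regularity is NOT proved by anything here; no summit is.

`𝒟_{C,K}`: Type-I ancient mild fields `W` (KNSS gauge, `IsTypeIAncientMild C W`) with Leray's
quarter-rate law. Lead g7 (`…FinalDatumProfile`) proved that a member with the space-time envelope
`A` and the scale-invariant package has a final datum `u₀`, a `C¹` divergence-free profile off the
apex with `‖u₀(x)‖ ≤ A/‖x‖`, attained at the rate `‖W(t,x) − u₀(x)‖ ≤ L₀(−t)/‖x‖³` (`x ≠ 0`).

* `lintegral_sub_sq_le_of_envelopes` (real analysis on `ℝ³`) and `lintegral_sub_finalDatum_sq_le` —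
  **THE SINGULAR PART HAS FINITE, VANISHING TOTAL ENERGY**: under the Type-I bound
  `‖W(t)‖ ≤ C/√(−t)`, the envelope of `u₀` and the rate, for every `t < 0`,
  `∫_{ℝ³} ‖W(t) − u₀‖² ≤ 3|B₁| (2C²/3 + 2A² + L₀²/3) √(−t)`: inside `B(0, √(−t))` by the two
  envelopes (`∫_{B_a} ‖x‖⁻² = 3|B₁| a`), outside by the rate (`∫_{B_aᶜ} ‖x‖⁻⁶ = |B₁| a⁻³`;
  `NewtonPotentialHolder.lintegral_(compl_)ball_norm_rpow_neg`). Neither `W(t)` nor `u₀` has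
  finite energy (both are `≍ ‖x‖⁻¹` at infinity, `u₀ ∉ L²_loc`-scale-invariantly at the apex);
  their DIFFERENCE does, and its energy vanishes at the parabolic rate. A profile of the residue is
  thus a finite-energy, energy-vanishing perturbation of its own final datum — the backward
  analogue of the splitting `u = e^{tΔ}u₀ + (finite energy)` of the forward discretely
  self-similar solutions (Bradshaw–Tsai), with `u₀` itself in place of its caloric lift.
* `aestronglyMeasurable_finalDatum`, `memLp_two_sub_finalDatum` — `u₀` is measurable (pointwise
  limit of the continuous slices off the null origin) and `W(t) − u₀ ∈ L²(ℝ³)` (`MemLp … 2`).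
* `exists_finalDatum_profile_energy` — packaged for the envelope class with the scale-invariant
  package `RellichScarScarRigidity.ScaleInvariantBounds`: the clauses of
  `FinalDatum.exists_finalDatum_profile` plus the energy clause `∫ ‖W(t) − u₀‖² ≤ M √(−t)`
  (skeleton v16 of line `birth`).
* `finalDatum_profile_energy_of_minimal` — the same for the CRITICAL ELEMENT (`K_c` minimal,
  `w ∈ 𝒟_{C,K_c}` singular; envelope from `Envelope.envelope_of_minimal`, package from
  `Envelope.scaleInvariantBounds_of_minimal`, seat ns-lqd-p2 g7), with `u₀` identified as the
  distributional trace off the apex.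

HONEST FRAMING. Elementary given lead g7's rate; the content is structural — which function
space the singular part of a putative Type-I profile lives in, and at what rate its energy
disappears — not a new exclusion: a discretely self-similar profile with factor `λ` would simply
have a `λ`-DSS remainder, consistent with the `√(−t)` law. With `…EnergyFloor` (core energy
`> δ √(−t)`) and `…TraceMorrey` (core energy `≤ Λ r √(−t)`) this completes the ENERGY PORTRAIT of
the residue. No summit is proved.

References: Koch–Nadirashvili–Seregin–Šverák, Acta Math. 203 (2009) = arXiv:0709.3599, §4;
Bradshaw–Tsai, Ann. Henri Poincaré 18 (2017), §1 (the `e^{tΔ}u₀ +` finite-energy splitting of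
forward DSS solutions); Chae–Wolf, arXiv:1610.09464, §2.
-/

noncomputable section

-- the summit and its single sub-problem share the name (CONVENTIONS §1), as in every Theorems file
set_option linter.dupNamespace false

namespace Summit.NavierStokesRegularity.NavierStokesRegularity.Theorems.FiniteDissipationLiouville.EnergyRemainder

open MeasureTheory Set Filter Topology Metric Function
open Literature.Analysis Literature.Analysis.FluidPDE
open Summit.NavierStokesRegularity.NavierStokesRegularity.Theorems.FiniteDissipationLiouville
open Summit.NavierStokesRegularity.NavierStokesRegularity.Theorems
open scoped ENNReal NNReal RealInnerProductSpace

/-! ### The finite-energy remainder -/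

/-- **Real-variable core of the remainder bound.** On `ℝ³`, if `‖v‖ ≤ C_v/a`, `‖u₀(x)‖ ≤ A/‖x‖`
off the origin and `‖v(x) − u₀(x)‖ ≤ L₀ a²/‖x‖³` off the origin (`a > 0`), then
`∫ ‖v − u₀‖² ≤ 3|B₁| (2C_v²/3 + 2A² + L₀²/3) a`: split at `‖x‖ = a`; inside, the two envelopes and
`∫_{B_a} ‖x‖⁻² = 3|B₁| a`; outside, the rate and `∫_{B_aᶜ} ‖x‖⁻⁶ = |B₁| a⁻³`. -/
theorem lintegral_sub_sq_le_of_envelopes {Cv A L₀ a : ℝ} (ha : 0 < a) (hCv : 0 ≤ Cv) (hA : 0 ≤ A)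
    (hL₀ : 0 ≤ L₀) {v u₀ : EuclideanSpace ℝ (Fin 3) → EuclideanSpace ℝ (Fin 3)}
    (hv : ∀ x, ‖v x‖ ≤ Cv / a)
    (hu₀ : ∀ x, x ≠ 0 → ‖u₀ x‖ ≤ A / ‖x‖)
    (hrate : ∀ x, x ≠ 0 → ‖v x - u₀ x‖ ≤ L₀ * a ^ 2 / ‖x‖ ^ 3) :
    ∫⁻ x, ‖v x - u₀ x‖ₑ ^ 2 ≤
      ENNReal.ofReal (3 * (volume : Measure (EuclideanSpace ℝ (Fin 3))).real (ball 0 1) *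
        (2 * Cv ^ 2 / 3 + 2 * A ^ 2 + L₀ ^ 2 / 3) * a) := by
  set V : ℝ := 3 * (volume : Measure (EuclideanSpace ℝ (Fin 3))).real (ball 0 1) with hV
  have hV0 : 0 ≤ V := by rw [hV]; positivity
  -- the origin is a null set
  have hne : ∀ᵐ x ∂(volume : Measure (EuclideanSpace ℝ (Fin 3))), x ≠ 0 := by
    rw [ae_iff]
    have e : {x : EuclideanSpace ℝ (Fin 3) | ¬ x ≠ 0} = {0} := by
      ext x; simp
    rw [e]
    exact measure_singleton 0
  -- `‖y‖ₑ² = ofReal (‖y‖²)`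
  have hsq : ∀ y : EuclideanSpace ℝ (Fin 3), ‖y‖ₑ ^ 2 = ENNReal.ofReal (‖y‖ ^ 2) := fun y => by
    rw [← ofReal_norm, ENNReal.ofReal_pow (norm_nonneg _)]
  -- pointwise bound near the apex
  have hin : ∀ x : EuclideanSpace ℝ (Fin 3), x ≠ 0 → ‖v x - u₀ x‖ₑ ^ 2 ≤
      ENNReal.ofReal (2 * Cv ^ 2 / a ^ 2) +
        ENNReal.ofReal (2 * A ^ 2) * ENNReal.ofReal (‖x‖ ^ (-(2 : ℝ))) := by
    intro x hx
    have hxpos : 0 < ‖x‖ := norm_pos_iff.2 hx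
    have h1 : ‖v x - u₀ x‖ ≤ Cv / a + A / ‖x‖ :=
      (norm_sub_le _ _).trans (add_le_add (hv x) (hu₀ x hx))
    have e : ‖x‖ ^ (-(2 : ℝ)) = (‖x‖ ^ 2)⁻¹ := by
      rw [Real.rpow_neg hxpos.le, Real.rpow_two]
    have h2 : ‖v x - u₀ x‖ ^ 2 ≤ 2 * Cv ^ 2 / a ^ 2 + 2 * A ^ 2 * ‖x‖ ^ (-(2 : ℝ)) := by
      rw [e]
      have hp : 0 ≤ Cv / a := div_nonneg hCv ha.le
      have hq : 0 ≤ A / ‖x‖ := div_nonneg hA hxpos.le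
      calc ‖v x - u₀ x‖ ^ 2 ≤ (Cv / a + A / ‖x‖) ^ 2 := pow_le_pow_left₀ (norm_nonneg _) h1 2
        _ ≤ 2 * (Cv / a) ^ 2 + 2 * (A / ‖x‖) ^ 2 := by nlinarith [sq_nonneg (Cv / a - A / ‖x‖)]
        _ = 2 * Cv ^ 2 / a ^ 2 + 2 * A ^ 2 * (‖x‖ ^ 2)⁻¹ := by
            field_simp
    calc ‖v x - u₀ x‖ₑ ^ 2 = ENNReal.ofReal (‖v x - u₀ x‖ ^ 2) := hsq _
      _ ≤ ENNReal.ofReal (2 * Cv ^ 2 / a ^ 2 + 2 * A ^ 2 * ‖x‖ ^ (-(2 : ℝ))) :=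
          ENNReal.ofReal_le_ofReal h2
      _ = _ := by
          rw [ENNReal.ofReal_add (by positivity) (by positivity), ENNReal.ofReal_mul (by positivity)]
  -- pointwise bound away from the apex
  have hout : ∀ x : EuclideanSpace ℝ (Fin 3), a ≤ ‖x‖ → ‖v x - u₀ x‖ₑ ^ 2 ≤
      ENNReal.ofReal (L₀ ^ 2 * a ^ 4) * ENNReal.ofReal (‖x‖ ^ (-(6 : ℝ))) := by
    intro x hx
    have hxpos : 0 < ‖x‖ := ha.trans_le hx
    have hx0 : x ≠ 0 := norm_pos_iff.1 hxpos
    have h1 := hrate x hx0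
    have e : ‖x‖ ^ (-(6 : ℝ)) = (‖x‖ ^ 6)⁻¹ := by
      rw [Real.rpow_neg hxpos.le, show (6 : ℝ) = ((6 : ℕ) : ℝ) by norm_num, Real.rpow_natCast]
    have h2 : ‖v x - u₀ x‖ ^ 2 ≤ L₀ ^ 2 * a ^ 4 * ‖x‖ ^ (-(6 : ℝ)) := by
      rw [e]
      have hnn : 0 ≤ L₀ * a ^ 2 / ‖x‖ ^ 3 := by positivity
      calc ‖v x - u₀ x‖ ^ 2 ≤ (L₀ * a ^ 2 / ‖x‖ ^ 3) ^ 2 := pow_le_pow_left₀ (norm_nonneg _) h1 2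
        _ = L₀ ^ 2 * a ^ 4 * (‖x‖ ^ 6)⁻¹ := by
            field_simp
    calc ‖v x - u₀ x‖ₑ ^ 2 = ENNReal.ofReal (‖v x - u₀ x‖ ^ 2) := hsq _
      _ ≤ ENNReal.ofReal (L₀ ^ 2 * a ^ 4 * ‖x‖ ^ (-(6 : ℝ))) := ENNReal.ofReal_le_ofReal h2
      _ = _ := ENNReal.ofReal_mul (by positivity)
  -- the volume of the ball `B(0, a)`
  have hball_vol : (volume : Measure (EuclideanSpace ℝ (Fin 3))) (ball 0 a) =
      ENNReal.ofReal (V / 3 * a ^ 3) := by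
    rw [Measure.addHaar_ball_of_pos volume (0 : EuclideanSpace ℝ (Fin 3)) ha,
      finrank_euclideanSpace, Fintype.card_fin,
      ← ofReal_measureReal (measure_ball_lt_top (μ := volume) (x := (0 : EuclideanSpace ℝ (Fin 3)))
        (r := 1)).ne, ← ENNReal.ofReal_mul (by positivity)]
    congr 1
    rw [hV]
    ring
  -- the inner integral
  have I1 : ∫⁻ x in ball (0 : EuclideanSpace ℝ (Fin 3)) a, ‖v x - u₀ x‖ₑ ^ 2 ≤
      ENNReal.ofReal ((2 * Cv ^ 2 / 3 + 2 * A ^ 2) * V * a) := by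
    calc ∫⁻ x in ball (0 : EuclideanSpace ℝ (Fin 3)) a, ‖v x - u₀ x‖ₑ ^ 2
        ≤ ∫⁻ x in ball (0 : EuclideanSpace ℝ (Fin 3)) a,
            (ENNReal.ofReal (2 * Cv ^ 2 / a ^ 2) +
              ENNReal.ofReal (2 * A ^ 2) * ENNReal.ofReal (‖x‖ ^ (-(2 : ℝ)))) := by
          refine lintegral_mono_ae ?_
          filter_upwards [ae_restrict_of_ae hne] with x hx
          exact hin x hx
      _ = ENNReal.ofReal (2 * Cv ^ 2 / a ^ 2) * (volume : Measure (EuclideanSpace ℝ (Fin 3))) (ball 0 a) +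
            ENNReal.ofReal (2 * A ^ 2) *
              ∫⁻ x in ball (0 : EuclideanSpace ℝ (Fin 3)) a, ENNReal.ofReal (‖x‖ ^ (-(2 : ℝ))) := by
          rw [lintegral_add_left' aemeasurable_const, lintegral_const_mul' _ _ ENNReal.ofReal_ne_top,
            setLIntegral_const]
      _ = ENNReal.ofReal (2 * Cv ^ 2 / a ^ 2) * ENNReal.ofReal (V / 3 * a ^ 3) +
            ENNReal.ofReal (2 * A ^ 2) * ENNReal.ofReal (V * (a ^ ((3 : ℝ) - 2) / (3 - 2))) := by
          rw [hball_vol, NewtonPotentialHolder.lintegral_ball_norm_rpow_neg (by norm_num) ha]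
      _ = ENNReal.ofReal ((2 * Cv ^ 2 / 3 + 2 * A ^ 2) * V * a) := by
          rw [← ENNReal.ofReal_mul (by positivity), ← ENNReal.ofReal_mul (by positivity),
            ← ENNReal.ofReal_add (by positivity) (by positivity)]
          congr 1
          have e : a ^ ((3 : ℝ) - 2) = a := by norm_num
          rw [e]
          field_simp
          ring
  -- the outer integral
  have I2 : ∫⁻ x in (ball (0 : EuclideanSpace ℝ (Fin 3)) a)ᶜ, ‖v x - u₀ x‖ₑ ^ 2 ≤
      ENNReal.ofReal (L₀ ^ 2 / 3 * V * a) := by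
    calc ∫⁻ x in (ball (0 : EuclideanSpace ℝ (Fin 3)) a)ᶜ, ‖v x - u₀ x‖ₑ ^ 2
        ≤ ∫⁻ x in (ball (0 : EuclideanSpace ℝ (Fin 3)) a)ᶜ,
            ENNReal.ofReal (L₀ ^ 2 * a ^ 4) * ENNReal.ofReal (‖x‖ ^ (-(6 : ℝ))) := by
          refine lintegral_mono_ae (ae_restrict_of_forall_mem measurableSet_ball.compl fun x hx => ?_)
          refine hout x ?_
          rw [mem_compl_iff, mem_ball_zero_iff, not_lt] at hx
          exact hx
      _ = ENNReal.ofReal (L₀ ^ 2 * a ^ 4) * ENNReal.ofReal (V * (a ^ ((3 : ℝ) - 6) / (6 - 3))) := by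
          rw [lintegral_const_mul' _ _ ENNReal.ofReal_ne_top,
            NewtonPotentialHolder.lintegral_compl_ball_norm_rpow_neg (by norm_num) ha]
      _ = ENNReal.ofReal (L₀ ^ 2 / 3 * V * a) := by
          rw [← ENNReal.ofReal_mul (by positivity)]
          congr 1
          have e : a ^ ((3 : ℝ) - 6) = (a ^ 3)⁻¹ := by
            rw [show (3 : ℝ) - 6 = -((3 : ℕ) : ℝ) by norm_num, Real.rpow_neg ha.le, Real.rpow_natCast]
          rw [e]
          field_simp
          ring
  -- assemble
  calc ∫⁻ x, ‖v x - u₀ x‖ₑ ^ 2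
      = (∫⁻ x in ball (0 : EuclideanSpace ℝ (Fin 3)) a, ‖v x - u₀ x‖ₑ ^ 2) +
          ∫⁻ x in (ball (0 : EuclideanSpace ℝ (Fin 3)) a)ᶜ, ‖v x - u₀ x‖ₑ ^ 2 :=
        (lintegral_add_compl _ measurableSet_ball).symm
    _ ≤ ENNReal.ofReal ((2 * Cv ^ 2 / 3 + 2 * A ^ 2) * V * a) + ENNReal.ofReal (L₀ ^ 2 / 3 * V * a) :=
        add_le_add I1 I2
    _ = ENNReal.ofReal (V * (2 * Cv ^ 2 / 3 + 2 * A ^ 2 + L₀ ^ 2 / 3) * a) := by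
        rw [← ENNReal.ofReal_add (by positivity) (by positivity)]
        congr 1
        ring

/-- **THE SINGULAR PART OF A TYPE-I PROFILE HAS FINITE, VANISHING ENERGY.** Let `W` be a Type-I
ancient mild field (KNSS gauge, constant `C`) with a final datum `u₀` off the apex in the sense of
`…FinalDatumProfile`: `‖u₀(x)‖ ≤ A/‖x‖` and `‖W(t,x) − u₀(x)‖ ≤ L₀(−t)/‖x‖³` for `x ≠ 0`, `t < 0`.
Then for every `t < 0` the remainder `W(t) − u₀` lies in `L²(ℝ³)` with
`∫ ‖W(t) − u₀‖² ≤ 3|B₁| (2C²/3 + 2A² + L₀²/3) √(−t)`. [cite: KochNadirashviliSereginSverak2009, §4 (arXiv:0709.3599 p. 8)] -/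
theorem lintegral_sub_finalDatum_sq_le {C A L₀ : ℝ}
    {W : ℝ → EuclideanSpace ℝ (Fin 3) → EuclideanSpace ℝ (Fin 3)}
    {u₀ : EuclideanSpace ℝ (Fin 3) → EuclideanSpace ℝ (Fin 3)} (hW : IsTypeIAncientMild C W)
    (hu₀ : ∀ x : EuclideanSpace ℝ (Fin 3), x ≠ 0 → ‖u₀ x‖ ≤ A / ‖x‖)
    (hrate : ∀ x : EuclideanSpace ℝ (Fin 3), x ≠ 0 → ∀ t : ℝ, t < 0 →
      ‖W t x - u₀ x‖ ≤ L₀ * (-t) / ‖x‖ ^ 3) :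
    ∀ t : ℝ, t < 0 → ∫⁻ x, ‖W t x - u₀ x‖ₑ ^ 2 ≤
      ENNReal.ofReal (3 * (volume : Measure (EuclideanSpace ℝ (Fin 3))).real (ball 0 1) *
        (2 * C ^ 2 / 3 + 2 * A ^ 2 + L₀ ^ 2 / 3) * Real.sqrt (-t)) := by
  intro t ht
  -- a nonzero unit vector, for the signs of the constants
  set e₀ : EuclideanSpace ℝ (Fin 3) := EuclideanSpace.single 0 1 with he₀
  have he₀n : ‖e₀‖ = 1 := by simp [he₀]
  have he₀0 : e₀ ≠ 0 := by
    intro h; rw [h, norm_zero] at he₀n; exact zero_ne_one he₀n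
  have hA : 0 ≤ A := by
    have h := hu₀ e₀ he₀0
    rw [he₀n, div_one] at h
    exact (norm_nonneg _).trans h
  have hL₀ : 0 ≤ L₀ := by
    have h := hrate e₀ he₀0 (-1) (by norm_num)
    rw [he₀n, one_pow, div_one, neg_neg, mul_one] at h
    exact (norm_nonneg _).trans h
  set a : ℝ := Real.sqrt (-t) with ha_def
  have ha : 0 < a := Real.sqrt_pos.2 (neg_pos.2 ht)
  have ha2 : a ^ 2 = -t := Real.sq_sqrt (neg_nonneg.2 ht.le)
  have hv : ∀ x, ‖W t x‖ ≤ C / a := fun x => hW.norm_le ht x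
  refine lintegral_sub_sq_le_of_envelopes ha hW.nonneg hA hL₀ hv hu₀ fun x hx => ?_
  rw [ha2]
  exact hrate x hx t ht

/-- **The final datum is measurable** (it is the pointwise limit, off the null origin, of the
continuous slices `W(−1/(n+1))`). -/
theorem aestronglyMeasurable_finalDatum {C L₀ : ℝ}
    {W : ℝ → EuclideanSpace ℝ (Fin 3) → EuclideanSpace ℝ (Fin 3)}
    {u₀ : EuclideanSpace ℝ (Fin 3) → EuclideanSpace ℝ (Fin 3)} (hW : IsTypeIAncientMild C W)
    (hrate : ∀ x : EuclideanSpace ℝ (Fin 3), x ≠ 0 → ∀ t : ℝ, t < 0 →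
      ‖W t x - u₀ x‖ ≤ L₀ * (-t) / ‖x‖ ^ 3) :
    AEStronglyMeasurable u₀ (volume : Measure (EuclideanSpace ℝ (Fin 3))) := by
  set τ : ℕ → ℝ := fun n => -(1 / ((n : ℝ) + 1)) with hτ
  have hτneg : ∀ n, τ n < 0 := fun n => by
    have : (0 : ℝ) < 1 / ((n : ℝ) + 1) := by positivity
    show -(1 / ((n : ℝ) + 1)) < 0
    linarith
  have hτt : Tendsto (fun n => -τ n) atTop (𝓝 0) := by
    have h := tendsto_one_div_add_atTop_nhds_zero_nat (𝕜 := ℝ)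
    refine h.congr fun n => ?_
    show 1 / ((n : ℝ) + 1) = -(-(1 / ((n : ℝ) + 1)))
    ring
  have hne : ∀ᵐ x ∂(volume : Measure (EuclideanSpace ℝ (Fin 3))), x ≠ 0 := by
    rw [ae_iff]
    have e : {x : EuclideanSpace ℝ (Fin 3) | ¬ x ≠ 0} = {0} := by
      ext x; simp
    rw [e]
    exact measure_singleton 0
  refine aestronglyMeasurable_of_tendsto_ae atTop (f := fun n x => W (τ n) x)
    (fun n => (hW.continuous_slice (hτneg n)).aestronglyMeasurable) ?_
  filter_upwards [hne] with x hx
  have hxpos : 0 < ‖x‖ := norm_pos_iff.2 hx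
  rw [tendsto_iff_norm_sub_tendsto_zero]
  have hb : Tendsto (fun n => L₀ * (-τ n) / ‖x‖ ^ 3) atTop (𝓝 0) := by
    have := (hτt.const_mul L₀).div_const (‖x‖ ^ 3)
    rw [mul_zero, zero_div] at this
    exact this
  exact squeeze_zero (fun n => norm_nonneg _) (fun n => hrate x hx (τ n) (hτneg n)) hb

/-- **`W(t) − u₀ ∈ L²(ℝ³)`** for every `t < 0`, under the hypotheses of
`lintegral_sub_finalDatum_sq_le`. -/
theorem memLp_two_sub_finalDatum {C A L₀ : ℝ}
    {W : ℝ → EuclideanSpace ℝ (Fin 3) → EuclideanSpace ℝ (Fin 3)}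
    {u₀ : EuclideanSpace ℝ (Fin 3) → EuclideanSpace ℝ (Fin 3)} (hW : IsTypeIAncientMild C W)
    (hu₀ : ∀ x : EuclideanSpace ℝ (Fin 3), x ≠ 0 → ‖u₀ x‖ ≤ A / ‖x‖)
    (hrate : ∀ x : EuclideanSpace ℝ (Fin 3), x ≠ 0 → ∀ t : ℝ, t < 0 →
      ‖W t x - u₀ x‖ ≤ L₀ * (-t) / ‖x‖ ^ 3) :
    ∀ t : ℝ, t < 0 → MemLp (fun x => W t x - u₀ x) 2 (volume : Measure (EuclideanSpace ℝ (Fin 3))) := by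
  intro t ht
  have hmeas : AEStronglyMeasurable (fun x => W t x - u₀ x)
      (volume : Measure (EuclideanSpace ℝ (Fin 3))) :=
    (hW.continuous_slice ht).aestronglyMeasurable.sub (aestronglyMeasurable_finalDatum hW hrate)
  refine ⟨hmeas, (eLpNorm_lt_top_iff_lintegral_rpow_enorm_lt_top two_ne_zero ENNReal.ofNat_ne_top).2 ?_⟩
  rw [ENNReal.toReal_ofNat]
  have h := lintegral_sub_finalDatum_sq_le hW hu₀ hrate t ht
  have e : (fun x => ‖W t x - u₀ x‖ₑ ^ (2 : ℝ)) = fun x => ‖W t x - u₀ x‖ₑ ^ 2 := by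
    funext x
    rw [show (2 : ℝ) = ((2 : ℕ) : ℝ) by norm_num, ENNReal.rpow_natCast]
  rw [e]
  exact lt_of_le_of_lt h ENNReal.ofReal_lt_top

/-! ### Packaged: envelope class with the scale-invariant package; the critical element -/

/-- **Final-datum profile WITH the energy clause.** For a Type-I ancient mild field with the
space-time envelope `A` and the scale-invariant package `ScaleInvariantBounds W Q` (the hypotheses
of `FinalDatum.exists_finalDatum_profile`, lead g7): the `C¹` divergence-free final datum `u₀` off
the apex with its rates, AND the finite-energy remainder
`∫ ‖W(t) − u₀‖² ≤ M √(−t)` for all `t < 0`. -/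
theorem exists_finalDatum_profile_energy {C A : ℝ}
    {W : ℝ → EuclideanSpace ℝ (Fin 3) → EuclideanSpace ℝ (Fin 3)}
    {Q : ℝ → EuclideanSpace ℝ (Fin 3) → ℝ} (hW : IsTypeIAncientMild C W) (hA : HasTypeIDecay A W)
    (hS : RellichScarScarRigidity.ScaleInvariantBounds W Q) :
    ∃ (u₀ : EuclideanSpace ℝ (Fin 3) → EuclideanSpace ℝ (Fin 3))
      (Du₀ : EuclideanSpace ℝ (Fin 3) → ((EuclideanSpace ℝ (Fin 3)) →L[ℝ] (EuclideanSpace ℝ (Fin 3))))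
      (L₀ L₁ M : ℝ), 0 ≤ L₀ ∧ 0 ≤ L₁ ∧ 0 ≤ M ∧
      (∀ x : EuclideanSpace ℝ (Fin 3), x ≠ 0 → ∀ t : ℝ, t < 0 →
        ‖W t x - u₀ x‖ ≤ L₀ * (-t) / ‖x‖ ^ 3) ∧
      (∀ x : EuclideanSpace ℝ (Fin 3), x ≠ 0 → ‖u₀ x‖ ≤ A / ‖x‖) ∧
      (∀ x : EuclideanSpace ℝ (Fin 3), x ≠ 0 → ∀ t : ℝ, t < 0 →
        ‖fderiv ℝ (W t) x - Du₀ x‖ ≤ L₁ * (-t) / ‖x‖ ^ 4) ∧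
      (∀ x : EuclideanSpace ℝ (Fin 3), x ≠ 0 → ‖Du₀ x‖ ≤ L₁ / ‖x‖ ^ 2) ∧
      (∀ x : EuclideanSpace ℝ (Fin 3), x ≠ 0 → HasFDerivAt u₀ (Du₀ x) x) ∧
      (∀ x : EuclideanSpace ℝ (Fin 3), x ≠ 0 → VectorCalculus.divergence u₀ x = 0) ∧
      (∀ t : ℝ, t < 0 → ∫⁻ x, ‖W t x - u₀ x‖ₑ ^ 2 ≤ ENNReal.ofReal (M * Real.sqrt (-t))) := by
  obtain ⟨u₀, Du₀, L₀, L₁, hL₀, hL₁, hrate, henv, hgrate, hgenv, hderiv, hdiv⟩ :=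
    FinalDatum.exists_finalDatum_profile hW hA hS
  have hAnn : 0 ≤ A := by
    have h := (norm_nonneg _).trans (hA (-1) (by norm_num) 0)
    simpa using h
  refine ⟨u₀, Du₀, L₀, L₁,
    3 * (volume : Measure (EuclideanSpace ℝ (Fin 3))).real (ball 0 1) *
      (2 * C ^ 2 / 3 + 2 * A ^ 2 + L₀ ^ 2 / 3),
    hL₀, hL₁, by positivity, hrate, henv, hgrate, hgenv, hderiv, hdiv, ?_⟩
  exact lintegral_sub_finalDatum_sq_le hW henv hrate

/-- **The finite-energy remainder of the CRITICAL ELEMENT** (`K_c` minimal, `w ∈ 𝒟_{C,K_c}`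
singular): there are the envelope constant `A`, the final datum `u₀` (a `C¹` divergence-free
profile off the apex, `‖u₀‖ ≤ A/‖x‖`, attained at the rate `L₀(−t)/‖x‖³`) and `M ≥ 0` with
`∫ ‖w(t) − u₀‖² ≤ M √(−t)` for every `t < 0`, and `u₀` IS the distributional trace off the apex.
Portrait clause of skeleton v16 of line `birth`. [cite: KochNadirashviliSereginSverak2009, §4 (arXiv:0709.3599 p. 8)] -/
theorem finalDatum_profile_energy_of_minimal {C Kc : ℝ}
    (hmin : ∀ K' : ℝ, K' < Kc → ∀ v : ℝ → EuclideanSpace ℝ (Fin 3) → EuclideanSpace ℝ (Fin 3),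
      IsTypeIAncientMild C v →
      (∀ s : ℝ, s < 0 → ∫⁻ x, ‖fderiv ℝ (v s) x‖ₑ ^ 2 ≤ ENNReal.ofReal (K' / Real.sqrt (-s))) →
      ¬ (∀ r > 0, ∀ M : ℝ, ∃ t ∈ Set.Ioo (-(r ^ 2)) (0 : ℝ),
        ∃ x ∈ Metric.ball (0 : EuclideanSpace ℝ (Fin 3)) r, M < ‖v t x‖))
    {w : ℝ → EuclideanSpace ℝ (Fin 3) → EuclideanSpace ℝ (Fin 3)} (hw : IsTypeIAncientMild C w)
    (hDw : ∀ s : ℝ, s < 0 → ∫⁻ x, ‖fderiv ℝ (w s) x‖ₑ ^ 2 ≤ ENNReal.ofReal (Kc / Real.sqrt (-s)))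
    (hsw : ∀ r > 0, ∀ M : ℝ, ∃ t ∈ Set.Ioo (-(r ^ 2)) (0 : ℝ),
      ∃ x ∈ Metric.ball (0 : EuclideanSpace ℝ (Fin 3)) r, M < ‖w t x‖) :
    ∃ (A L₀ M : ℝ) (u₀ : EuclideanSpace ℝ (Fin 3) → EuclideanSpace ℝ (Fin 3)),
      0 ≤ A ∧ 0 ≤ L₀ ∧ 0 ≤ M ∧ HasTypeIDecay A w ∧
      (∀ x : EuclideanSpace ℝ (Fin 3), x ≠ 0 → ∀ t : ℝ, t < 0 →
        ‖w t x - u₀ x‖ ≤ L₀ * (-t) / ‖x‖ ^ 3) ∧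
      (∀ x : EuclideanSpace ℝ (Fin 3), x ≠ 0 → ‖u₀ x‖ ≤ A / ‖x‖) ∧
      (∀ t : ℝ, t < 0 → MemLp (fun x => w t x - u₀ x) 2 (volume : Measure (EuclideanSpace ℝ (Fin 3)))) ∧
      (∀ t : ℝ, t < 0 → ∫⁻ x, ‖w t x - u₀ x‖ₑ ^ 2 ≤ ENNReal.ofReal (M * Real.sqrt (-t))) ∧
      (∀ (ψ : EuclideanSpace ℝ (Fin 3) → EuclideanSpace ℝ (Fin 3)) (r : ℝ), 0 < r →
        FunctionSpaces.IsTestFunctionOn (⊤ : TopologicalSpace.Opens (EuclideanSpace ℝ (Fin 3))) ψ →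
        (∀ x, ψ x ≠ 0 → r < ‖x‖) →
        Tendsto (fun t => ∫ x, ⟪w t x, ψ x⟫) (𝓝[<] 0) (𝓝 (∫ x, ⟪u₀ x, ψ x⟫))) := by
  obtain ⟨A, L₀, L₁, u₀, Du₀, hA0, hL₀, -, hdec, hrate, henv, -, -, -, -, htrace⟩ :=
    FinalDatum.finalDatum_profile_of_minimal hmin hw hDw hsw
  refine ⟨A, L₀,
    3 * (volume : Measure (EuclideanSpace ℝ (Fin 3))).real (ball 0 1) *
      (2 * C ^ 2 / 3 + 2 * A ^ 2 + L₀ ^ 2 / 3),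
    u₀, hA0, hL₀, by positivity, hdec, hrate, henv, memLp_two_sub_finalDatum hw henv hrate,
    lintegral_sub_finalDatum_sq_le hw henv hrate, htrace⟩

end Summit.NavierStokesRegularity.NavierStokesRegularity.Theorems.FiniteDissipationLiouville.EnergyRemainder

end
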